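import Literature.Algebra.EuclideanLattices.LatticeCosetPointCounting
import HarnessLib

/-!
# Lattice points in coordinate boxes, uniformly in the box

Topic `Literature/Algebra/EuclideanLattices` (geometry of numbers). Everything in this file is
PROVED (theorems only).

For a fixed full lattice `Λ = span_ℤ b` in `ℝ^κ` (sup norm) and an arbitrary coordinate box `B`
with `∏ (loᵢ, hiᵢ) ⊆ B ⊆ ∏ [loᵢ, hiᵢ]` (any choice of half-open faces) whose sides are all `≤ L`,
`L ≥ 1`:

  `|#(B ∩ Λ) − vol(B)/covol(Λ)| ≤ C_b · L^{d−1}`,   `vol(B) = ∏ (hiᵢ − loᵢ)`, `d = #κ ≥ 1`,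

with `C_b` depending only on the basis `b` (`abs_card_inter_coordBox_sub_le`) — not on the position,
the shape or the half-openness of the box. This is the form of Marcus's Lemma 2 / Lang's Theorem
VI §2.2 needed to count the elements of an ideal `𝔮 ⊆ 𝓞_K` in a box *uniformly in `𝔮`*: after
replacing `𝔮` by finitely many cosets of a principal sublattice `x₁𝓞_K`, one counts points of the
fixed lattice `𝓞_K` in the boxes `x₁⁻¹ ·` (box), whose sides vary with `𝔮` (Castillo–Hall–Lemke
Oliver–Pollack–Thompson, arXiv:1403.5808, §2.1: "The estimate for `|∂A(N, 𝔮)|` comes from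
estimating the number of translates of the fundamental parallelogram that intersect the boundary
of that region"). The proof is the cell count of `LatticePointCounting.lean`
(`abs_card_sub_div_le_of_cover`) with an explicit cover of the `2d` faces of the box, each the
image of `[0,1]^{d−1}` under an `L`-Lipschitz affine map, by `(L + 3)^{d−1}` unit balls
(`exists_cover_image_cube`).

## References

* D. A. Marcus, *Number Fields*, 2nd ed., Springer 2018, Ch. 6, Lemma 2 and its proof (pp. 126–127).
  [Marcus2018]
* S. Lang, *Algebraic Number Theory*, 2nd ed., GTM 110, Ch. VI §2, Theorem 2.
-/

noncomputable section

open MeasureTheory Module Submodule Bornology Set Metric ZSpan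
open scoped NNReal ENNReal Classical Pointwise

namespace Literature.Algebra.EuclideanLattices

variable {κ : Type*} [Fintype κ]

/-! ## The faces of a coordinate box -/

/-- The affine parametrization of the face `{x_i = c}` of the box `∏ [lo_j, hi_j]` by the cube
`[0,1]^{κ ∖ {i}}` (reindexed by `Fin m`): `q ↦ (j ↦ lo_j + q_j (hi_j − lo_j))`, `x_i = c`.
[cite: Marcus2018, Ch. 6, proof of Lemma 2] -/
def coordBoxFace (lo hi : κ → ℝ) (i : κ) (c : ℝ) {m : ℕ} (e : {j : κ // j ≠ i} ≃ Fin m)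
    (q : Fin m → ℝ) : κ → ℝ :=
  fun j => if h : j = i then c else lo j + q (e ⟨j, h⟩) * (hi j - lo j)

omit [Fintype κ] in
/-- The face maps are `L`-Lipschitz when all sides are `≤ L` (sup metrics). [folklore] -/
theorem lipschitzWith_coordBoxFace {lo hi : κ → ℝ} {L : ℝ≥0} [Fintype κ]
    (hside : ∀ j, 0 ≤ hi j - lo j ∧ hi j - lo j ≤ L) (i : κ) (c : ℝ) {m : ℕ}
    (e : {j : κ // j ≠ i} ≃ Fin m) : LipschitzWith L (coordBoxFace lo hi i c e) := by
  refine LipschitzWith.of_dist_le_mul fun q q' => ?_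
  refine (dist_pi_le_iff (by positivity)).2 fun j => ?_
  by_cases h : j = i
  · simp [coordBoxFace, h]
    positivity
  · simp only [coordBoxFace, h, dite_false]
    rw [Real.dist_eq, show lo j + q (e ⟨j, h⟩) * (hi j - lo j) - (lo j + q' (e ⟨j, h⟩) * (hi j - lo j)) =
      (q (e ⟨j, h⟩) - q' (e ⟨j, h⟩)) * (hi j - lo j) by ring, abs_mul,
      abs_of_nonneg (hside j).1, mul_comm]
    refine mul_le_mul (hside j).2 ?_ (abs_nonneg _) (by positivity)
    rw [← Real.dist_eq]
    exact dist_le_pi_dist q q' _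

omit [Fintype κ] in
/-- A point of the closed box off the open box lies on one of the `2d` faces.
[cite: Marcus2018, Ch. 6, proof of Lemma 2] -/
theorem exists_coordBoxFace_of_mem_Icc_not_mem_Ioo {lo hi : κ → ℝ} (hlohi : ∀ j, lo j ≤ hi j)
    {m : ℕ} (e : ∀ i : κ, {j : κ // j ≠ i} ≃ Fin m) {x : κ → ℝ}
    (hx₁ : x ∈ Set.pi univ fun j => Icc (lo j) (hi j))
    (hx₂ : x ∉ Set.pi univ fun j => Ioo (lo j) (hi j)) :
    ∃ (i : κ) (s : Fin 2), x ∈ coordBoxFace lo hi i (if s = 0 then lo i else hi i) (e i) ''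
      Icc (0 : Fin m → ℝ) 1 := by
  rw [Set.mem_univ_pi] at hx₁
  rw [Set.mem_univ_pi, not_forall] at hx₂
  obtain ⟨i, hnot⟩ := hx₂
  have hxi : x i = lo i ∨ x i = hi i := by
    rcases (hx₁ i) with ⟨h0, h1⟩
    rcases h0.lt_or_eq with h0' | h0'
    · rcases h1.lt_or_eq with h1' | h1'
      · exact absurd ⟨h0', h1'⟩ hnot
      · exact Or.inr h1'
    · exact Or.inl h0'.symm
  -- the parameter of `x` on the face
  set q : Fin m → ℝ := fun k =>
    if hi ((e i).symm k).1 = lo ((e i).symm k).1 then 0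
    else (x ((e i).symm k).1 - lo ((e i).symm k).1) / (hi ((e i).symm k).1 - lo ((e i).symm k).1)
    with hq
  have hqmem : q ∈ Icc (0 : Fin m → ℝ) 1 := by
    rw [mem_cube_iff]
    intro k
    simp only [hq]
    split_ifs with h
    · exact ⟨le_rfl, zero_le_one⟩
    · have hj := hx₁ ((e i).symm k).1
      have hlt : lo ((e i).symm k).1 < hi ((e i).symm k).1 :=
        lt_of_le_of_ne (hlohi _) (Ne.symm h)
      constructor
      · exact div_nonneg (by linarith [hj.1]) (by linarith)
      · rw [div_le_one (by linarith)]; linarith [hj.2]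
  have hface : ∀ c : ℝ, x i = c → coordBoxFace lo hi i c (e i) q = x := by
    intro c hc
    funext j
    by_cases h : j = i
    · subst h; simp [coordBoxFace, hc]
    · simp only [coordBoxFace, h, dite_false, hq, Equiv.symm_apply_apply]
      split_ifs with h'
      · have hj := hx₁ j
        rw [h'] at hj
        have : x j = lo j := le_antisymm hj.2 hj.1
        rw [this]; ring
      · have hlt : lo j < hi j := lt_of_le_of_ne (hlohi _) (Ne.symm h')
        field_simp
        ring
  rcases hxi with hxi | hxi
  · exact ⟨i, 0, q, hqmem, hface _ hxi⟩
  · exact ⟨i, 1, q, hqmem, by simpa using hface _ hxi⟩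

/-! ## The uniform count -/

omit [Fintype κ] in
/-- The volume of any box between the open and the closed coordinate box is `∏ (hiⱼ − loⱼ)` (no
measurability needed: outer measure squeezed between two equal volumes). [folklore] -/
theorem volume_real_coordBox [Fintype κ] {lo hi : κ → ℝ} (hlohi : ∀ j, lo j ≤ hi j) {B : Set (κ → ℝ)}
    (hB₁ : (Set.pi univ fun j => Ioo (lo j) (hi j)) ⊆ B)
    (hB₂ : B ⊆ Set.pi univ fun j => Icc (lo j) (hi j)) :
    volume.real B = ∏ j, (hi j - lo j) := by
  have h1 : volume B ≤ ∏ j, ENNReal.ofReal (hi j - lo j) := by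
    calc volume B ≤ volume (Set.pi univ fun j => Icc (lo j) (hi j)) := measure_mono hB₂
      _ = ∏ j, ENNReal.ofReal (hi j - lo j) := by rw [Set.pi_univ_Icc]; exact Real.volume_Icc_pi
  have h2 : ∏ j, ENNReal.ofReal (hi j - lo j) ≤ volume B := by
    calc ∏ j, ENNReal.ofReal (hi j - lo j) = volume (Set.pi univ fun j => Ioo (lo j) (hi j)) :=
          Real.volume_pi_Ioo.symm
      _ ≤ volume B := measure_mono hB₁
  rw [measureReal_def, le_antisymm h1 h2, ENNReal.toReal_prod]
  exact Finset.prod_congr rfl fun j _ => ENNReal.toReal_ofReal (sub_nonneg.2 (hlohi j))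

variable {ι : Type*} [Fintype ι]

/-- **Lattice points in coordinate boxes, uniformly in the box** (Marcus, Ch. 6, Lemma 2, in a form
uniform over all boxes): for a real basis `b` of `ℝ^κ` (`d = #κ ≥ 1`) with lattice `Λ = span_ℤ b`
and fundamental parallelepiped `P`, there is `C` (depending on `b` only) such that for every
coordinate box `∏ (loⱼ, hiⱼ) ⊆ B ⊆ ∏ [loⱼ, hiⱼ]` with all sides `hiⱼ − loⱼ ≤ L`, `L ≥ 1`,
`|#(B ∩ Λ) − ∏ (hiⱼ − loⱼ)/vol(P)| ≤ C L^{d−1}`. The frontier of `B` lies on the `2d` faces, each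
an `L`-Lipschitz image of `[0,1]^{d−1}` covered by `(L+3)^{d−1}` unit balls, and a unit ball meets
at most `vol(B(0, 1+2R_b))/vol(P)` cells. [cite: Marcus2018, Ch. 6, Lemma 2 (proof, pp. 126–127)] -/
theorem abs_card_inter_coordBox_sub_le [Nonempty κ] (b : Basis ι ℝ (κ → ℝ)) :
    ∃ C : ℝ, ∀ (lo hi : κ → ℝ) (L : ℝ), 1 ≤ L → (∀ j, lo j ≤ hi j) → (∀ j, hi j - lo j ≤ L) →
      ∀ B : Set (κ → ℝ), (Set.pi univ fun j => Ioo (lo j) (hi j)) ⊆ B →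
        B ⊆ (Set.pi univ fun j => Icc (lo j) (hi j)) →
        |(Nat.card (B ∩ (span ℤ (Set.range b) : Set (κ → ℝ)) : Set (κ → ℝ)) : ℝ) -
            (∏ j, (hi j - lo j)) / volume.real (fundamentalDomain b)| ≤
          C * L ^ (Fintype.card κ - 1) := by
  set d : ℕ := Fintype.card κ with hd
  set M : ℝ := volume.real (closedBall (0 : κ → ℝ) (1 + 2 * cellRadius b)) /
    volume.real (fundamentalDomain b) with hM
  have hM0 : 0 ≤ M := div_nonneg measureReal_nonneg measureReal_nonneg
  refine ⟨2 * d * 4 ^ (d - 1) * M, fun lo hi L hL hlohi hside B hB₁ hB₂ => ?_⟩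
  have hL0 : 0 ≤ L := by linarith
  -- reindexing the faces by `Fin (d − 1)`
  have hcard : ∀ i : κ, Fintype.card {j : κ // j ≠ i} = d - 1 := fun i => by
    rw [Fintype.card_subtype_compl, Fintype.card_subtype_eq]
  let e : ∀ i : κ, {j : κ // j ≠ i} ≃ Fin (d - 1) := fun i => Fintype.equivFinOfCardEq (hcard i)
  have hside' : ∀ j, 0 ≤ hi j - lo j ∧ hi j - lo j ≤ ((Real.toNNReal L : ℝ≥0) : ℝ) := fun j =>
    ⟨sub_nonneg.2 (hlohi j), by rw [Real.coe_toNNReal _ hL0]; exact hside j⟩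
  -- covers of the `2d` faces by unit balls
  have hcov : ∀ (i : κ) (s : Fin 2), ∃ Y : Finset (κ → ℝ), (Y.card : ℝ) ≤ (L + 3) ^ (d - 1) ∧
      coordBoxFace lo hi i (if s = 0 then lo i else hi i) (e i) '' Icc (0 : Fin (d - 1) → ℝ) 1 ⊆
        ⋃ y ∈ Y, closedBall y 1 := by
    intro i s
    obtain ⟨Y, hY, hcov⟩ := exists_cover_image_cube
      ((lipschitzWith_coordBoxFace hside' i (if s = 0 then lo i else hi i) (e i)).lipschitzOnWith
        (s := Icc (0 : Fin (d - 1) → ℝ) 1))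
    refine ⟨Y, ?_, hcov⟩
    rwa [Real.coe_toNNReal _ hL0] at hY
  choose Y hYcard hYcov using hcov
  set Yall : Finset (κ → ℝ) := Finset.univ.biUnion fun p : κ × Fin 2 => Y p.1 p.2 with hYall
  -- the frontier of `B` is covered
  have hBdd : IsBounded B := by
    refine (isBounded_Icc lo hi).subset (hB₂.trans ?_)
    rw [← Set.pi_univ_Icc]
  have hfront : frontier B ⊆ ⋃ y ∈ Yall, closedBall y 1 := by
    intro x hx
    have hx₁ : x ∈ Set.pi univ fun j => Icc (lo j) (hi j) :=
      (closure_minimal hB₂ (isClosed_set_pi fun j _ => isClosed_Icc)) hx.1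
    have hx₂ : x ∉ Set.pi univ fun j => Ioo (lo j) (hi j) := fun h =>
      hx.2 ((interior_maximal hB₁ (isOpen_set_pi finite_univ fun j _ => isOpen_Ioo)) h)
    obtain ⟨i, s, hmem⟩ := exists_coordBoxFace_of_mem_Icc_not_mem_Ioo hlohi e hx₁ hx₂
    have h := hYcov i s hmem
    simp only [Set.mem_iUnion] at h ⊢
    obtain ⟨y, hy, hy'⟩ := h
    exact ⟨y, Finset.mem_biUnion.2 ⟨(i, s), Finset.mem_univ _, hy⟩, hy'⟩
  have hcount := abs_card_sub_div_le_of_cover b volume hBdd hfront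
  rw [volume_real_coordBox hlohi hB₁ hB₂] at hcount
  -- the number of balls
  have hYall : (Yall.card : ℝ) ≤ 2 * d * (L + 3) ^ (d - 1) := by
    calc (Yall.card : ℝ) ≤ ∑ p : κ × Fin 2, ((Y p.1 p.2).card : ℝ) := by
          rw [hYall]; exact_mod_cast Finset.card_biUnion_le
      _ ≤ ∑ p : κ × Fin 2, (L + 3) ^ (d - 1) := Finset.sum_le_sum fun p _ => hYcard p.1 p.2
      _ = 2 * d * (L + 3) ^ (d - 1) := by
          rw [Finset.sum_const, Finset.card_univ, Fintype.card_prod, Fintype.card_fin, nsmul_eq_mul]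
          push_cast
          ring
  have hL3 : (L + 3) ^ (d - 1) ≤ 4 ^ (d - 1) * L ^ (d - 1) := by
    rw [← mul_pow]
    exact pow_le_pow_left₀ (by linarith) (by linarith) _
  calc |(Nat.card (B ∩ (span ℤ (Set.range b) : Set (κ → ℝ)) : Set (κ → ℝ)) : ℝ) -
          (∏ j, (hi j - lo j)) / volume.real (fundamentalDomain b)|
      ≤ Yall.card * M := hcount
    _ ≤ (2 * d * (L + 3) ^ (d - 1)) * M := mul_le_mul_of_nonneg_right hYall hM0
    _ ≤ (2 * d * (4 ^ (d - 1) * L ^ (d - 1))) * M := by gcongr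
    _ = 2 * d * 4 ^ (d - 1) * M * L ^ (d - 1) := by ring

/-- **Coset form**: the same bound for the points of any coset `v + Λ` in the box (translate the
box by `−v`; it is again a coordinate box with the same sides). [cite: Marcus2018, Ch. 6, Lemma 2 (proof, pp. 126–127)] -/
theorem abs_card_inter_coordBox_vadd_sub_le [Nonempty κ] (b : Basis ι ℝ (κ → ℝ)) :
    ∃ C : ℝ, ∀ (lo hi : κ → ℝ) (L : ℝ), 1 ≤ L → (∀ j, lo j ≤ hi j) → (∀ j, hi j - lo j ≤ L) →
      ∀ B : Set (κ → ℝ), (Set.pi univ fun j => Ioo (lo j) (hi j)) ⊆ B →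
        B ⊆ (Set.pi univ fun j => Icc (lo j) (hi j)) → ∀ v : κ → ℝ,
        |(Nat.card (B ∩ (v +ᵥ (span ℤ (Set.range b) : Set (κ → ℝ))) : Set (κ → ℝ)) : ℝ) -
            (∏ j, (hi j - lo j)) / volume.real (fundamentalDomain b)| ≤
          C * L ^ (Fintype.card κ - 1) := by
  obtain ⟨C, hC⟩ := abs_card_inter_coordBox_sub_le b
  refine ⟨C, fun lo hi L hL hlohi hside B hB₁ hB₂ v => ?_⟩
  rw [card_inter_vadd_eq]
  have h := hC (fun j => lo j - v j) (fun j => hi j - v j) L hL (fun j => by linarith [hlohi j])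
    (fun j => by linarith [hside j]) ((-v) +ᵥ B) ?_ ?_
  · have hprod : ∏ j, (hi j - v j - (lo j - v j)) = ∏ j, (hi j - lo j) :=
      Finset.prod_congr rfl fun j _ => by ring
    rwa [hprod] at h
  · intro x hx
    rw [Set.mem_univ_pi] at hx
    refine Set.mem_vadd_set.2 ⟨v + x, hB₁ (Set.mem_univ_pi.2 fun j => ?_), by simp⟩
    have := hx j
    simp only [Set.mem_Ioo, Pi.add_apply] at this ⊢
    constructor <;> linarith [this.1, this.2]
  · intro x hx
    obtain ⟨y, hy, rfl⟩ := Set.mem_vadd_set.1 hx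
    have hy' := Set.mem_univ_pi.1 (hB₂ hy)
    refine Set.mem_univ_pi.2 fun j => ?_
    have := hy' j
    simp only [Set.mem_Icc, vadd_eq_add, Pi.add_apply, Pi.neg_apply] at this ⊢
    constructor <;> linarith [this.1, this.2]

end Literature.Algebra.EuclideanLattices
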